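import Summits.Ventures.PackingBounds.ThreePointCert.SoundExactLift

/-!
# Soundness of the exact three-point certificate checker, IV: the three-point part

Framing: lottery ticket; floor = certified bounds/negative ranges. Venture `PackingBounds`
(cell `pub-packcert`), three-point SDP family.

Entries of the densely lifted blocks (`MrowU_entry`, `sumMU_eq`), the value of the three-point
expansion (`eval_FPolyX = W · FvalX`), its symmetry, and Bachoc–Vallentin positivity (pos S) of
`FvalX` over every finite set of unit vectors of `ℝⁿ`, `n ≥ 4` (`tripleSum_FvalX_nonneg`).
-/

noncomputable section

open Finset
open scoped RealInnerProductSpace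

namespace Summit.Ventures.PackingBounds.ThreePointCert

open Literature.Geometry.DiscreteGeometry Literature.Geometry.DiscreteGeometry.PolyCert
open Literature.Geometry.DiscreteGeometry.PolyCert.SPoly
open Literature.Analysis.SpecialFunctions

/-! ### The three-point part with densely lifted face blocks -/

/-- Entry `(j, a)` of a dense lift `U`. -/
def Uent (U : List (List ℤ)) (j a : ℕ) : ℤ := (U.getD j []).getD a 0

/-- Shape hypotheses of a densely lifted face block. -/
structure ULiftOK (U : List (List ℤ)) (p : PSDBlk) : Prop where
  /-- the rows have length `f` -/
  hU : ∀ r ∈ U, r.length = p.f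
  /-- the face block passes `psdOK` -/
  hp : psdOK p = true

/-- `MrowU`: length `|U|` and entries `Σ_{a,b<f} U(j,a) S(a,b) U(l,b)`. -/
theorem MrowU_entry (U : List (List ℤ)) (p : PSDBlk) (h : ULiftOK U p) (j l : ℕ) (hj : j < U.length)
    (hl : l < U.length) :
    (MrowU U (Srows p) p.f j).getD l 0 =
      ∑ a ∈ range p.f, ∑ b ∈ range p.f, Uent U j a * Sent p a b * Uent U l b := by
  obtain ⟨hS, hSr, hSe⟩ := Srows_spec p
  have hUj : (U.getD j []).length = p.f := by
    rw [List.getD_eq_getElem?_getD, List.getElem?_eq_getElem hj]; exact h.hU _ (List.getElem_mem _)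
  have hUl : (U.getD l []).length = p.f := by
    rw [List.getD_eq_getElem?_getD, List.getElem?_eq_getElem hl]; exact h.hU _ (List.getElem_mem _)
  have hW := combRows_spec p.f (U.getD j []) (Srows p) hSr (by rw [hUj, hS])
  unfold MrowU
  rw [List.getD_eq_getElem?_getD, List.getElem?_map, List.getElem?_eq_getElem hl]
  simp only [Option.map_some, Option.getD_some]
  have hUl' : (U[l]).length = p.f := h.hU _ (List.getElem_mem _)
  rw [dotZ_eq_sum _ _ 0 (by rw [hW.1, hUl']), hW.1, zero_add, Finset.sum_comm]
  refine Finset.sum_congr rfl fun b hb => ?_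
  rw [hW.2 b (mem_range.1 hb), hUj, Finset.sum_mul]
  refine Finset.sum_congr rfl fun a ha => ?_
  rw [hSe a b (mem_range.1 ha) (mem_range.1 hb)]
  have hUl2 : U.getD l [] = U[l] := by
    rw [List.getD_eq_getElem?_getD, List.getElem?_eq_getElem hl, Option.getD_some]
  unfold Uent
  rw [hUl2]

/-- Length of `MrowU`. -/
theorem MrowU_length (U : List (List ℤ)) (S : List (List ℤ)) (f j : ℕ) : (MrowU U S f j).length = U.length := by
  simp [MrowU]

/-- `Σ_{j,l<m} (U S Uᵀ)_{jl} Ψ(j,l) = Σ_{c,e<f} S(c,e) Σ_{j,l<m} U(j,c) U(l,e) Ψ(j,l)` for any `Ψ`. -/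
theorem sumMU_eq (U : List (List ℤ)) (p : PSDBlk) (h : ULiftOK U p) (Ψ : ℕ → ℕ → ℝ) :
    ∑ j ∈ range U.length, ∑ l ∈ range U.length, ((MrowU U (Srows p) p.f j).getD l 0 : ℝ) * Ψ j l =
      ∑ c ∈ range p.f, ∑ e ∈ range p.f, (Sent p c e : ℝ) *
        ∑ j ∈ range U.length, ∑ l ∈ range U.length, (Uent U j c : ℝ) * (Uent U l e : ℝ) * Ψ j l := by
  have e1 : ∀ j ∈ range U.length, ∀ l ∈ range U.length, ((MrowU U (Srows p) p.f j).getD l 0 : ℝ) * Ψ j l =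
      ∑ c ∈ range p.f, ∑ e ∈ range p.f, (Sent p c e : ℝ) * ((Uent U j c : ℝ) * (Uent U l e : ℝ) * Ψ j l) := by
    intro j hj l hl
    rw [MrowU_entry U p h j l (mem_range.1 hj) (mem_range.1 hl)]
    push_cast
    rw [Finset.sum_mul]
    refine Finset.sum_congr rfl fun c _ => ?_
    rw [Finset.sum_mul]
    refine Finset.sum_congr rfl fun e _ => ?_
    ring
  rw [Finset.sum_congr rfl fun j hj => Finset.sum_congr rfl fun l hl => e1 j hj l hl]
  have s1 : ∀ j ∈ range U.length, ∑ l ∈ range U.length, ∑ c ∈ range p.f, ∑ e ∈ range p.f,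
      (Sent p c e : ℝ) * ((Uent U j c : ℝ) * (Uent U l e : ℝ) * Ψ j l) =
      ∑ c ∈ range p.f, ∑ e ∈ range p.f, ∑ l ∈ range U.length,
      (Sent p c e : ℝ) * ((Uent U j c : ℝ) * (Uent U l e : ℝ) * Ψ j l) := by
    intro j _
    rw [Finset.sum_comm]
    exact Finset.sum_congr rfl fun c _ => Finset.sum_comm
  rw [Finset.sum_congr rfl s1, Finset.sum_comm]
  refine Finset.sum_congr rfl fun c _ => ?_
  rw [Finset.sum_comm]
  refine Finset.sum_congr rfl fun e _ => ?_
  rw [Finset.mul_sum]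
  refine Finset.sum_congr rfl fun j _ => ?_
  rw [Finset.mul_sum]

/-- `tripleSum` of a finite sum. -/
theorem tripleSum_finsum {n : ℕ} {ι : Type*} (C : Finset (EuclideanSpace ℝ (Fin n))) (s : Finset ι)
    (f : ι → ℝ → ℝ → ℝ → ℝ) :
    BachocVallentin.tripleSum C (fun u v t => ∑ i ∈ s, f i u v t) = ∑ i ∈ s, BachocVallentin.tripleSum C (f i) := by
  unfold BachocVallentin.tripleSum
  symm
  rw [Finset.sum_comm]
  refine Finset.sum_congr rfl fun x _ => ?_
  rw [Finset.sum_comm]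
  refine Finset.sum_congr rfl fun y _ => ?_
  rw [Finset.sum_comm]

/-- `tripleSum` of a constant multiple. -/
theorem tripleSum_const_mul {n : ℕ} (C : Finset (EuclideanSpace ℝ (Fin n))) (c : ℝ) (f : ℝ → ℝ → ℝ → ℝ) :
    BachocVallentin.tripleSum C (fun u v t => c * f u v t) = c * BachocVallentin.tripleSum C f := by
  unfold BachocVallentin.tripleSum
  simp only [Finset.mul_sum]

/-- `Q n k` is symmetric in `u, v`. -/
theorem Q_swap (n k : ℕ) (u v t : ℝ) : BachocVallentin.Q n k u v t = BachocVallentin.Q n k v u t := by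
  unfold BachocVallentin.Q
  congr 1 <;> ring

/-- The value of a three-point block: `Σ_{a,l<m} M_{al} sym6(u^a v^l Q n k)`, `M = U S Uᵀ`. -/
def blkValX (n : ℕ) (b : FBlkX) (u v t : ℝ) : ℝ :=
  ∑ a ∈ range b.U.length, ∑ l ∈ range b.U.length, ((MrowU b.U (Srows b.psd) b.psd.f a).getD l 0 : ℝ) *
    sym6 (fun u v t => u ^ a * v ^ l * BachocVallentin.Q n b.k u v t) u v t

/-- The value of the three-point part of an exact certificate (units `1/Λ`). -/
def FvalX (n : ℕ) (bs : List FBlkX) (u v t : ℝ) : ℝ := (bs.map fun b => blkValX n b u v t).sum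

/-- Unpacked `fblkShapeOK`. -/
theorem fblkShapeOK_spec (d : ℕ) (b : FBlkX) (h : fblkShapeOK d b = true) :
    b.k ≤ d ∧ ULiftOK b.U b.psd := by
  unfold fblkShapeOK at h
  simp only [Bool.and_eq_true, decide_eq_true_eq, List.all_eq_true] at h
  obtain ⟨⟨h1, h2⟩, h3⟩ := h
  exact ⟨h1, ⟨h2, h3⟩⟩

/-- `eval (FbPolyX n d b) = W · blkValX n b`. -/
theorem eval_FbPolyX (n d : ℕ) (b : FBlkX) (hb : fblkShapeOK d b = true) (u v t : ℝ) :
    eval (FbPolyX n d b) u v t = (Wfac d : ℝ) * blkValX n b u v t := by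
  obtain ⟨hk, hL⟩ := fblkShapeOK_spec d b hb
  have hW : (Mfac d b.k : ℝ) * (2 ^ b.k * (b.k.factorial : ℝ)) = (Wfac d : ℝ) := by
    exact_mod_cast Mfac_mul d b.k hk
  unfold FbPolyX blkValX
  rw [eval_smul, eval_mergeAllB, List.map_map, list_sum_map_range, Finset.mul_sum, Finset.mul_sum]
  refine Finset.sum_congr rfl fun a ha => ?_
  have hM := MrowU_length b.U (Srows b.psd) b.psd.f a
  simp only [Function.comp_apply]
  rw [eval_mergeAllB, sum_map_zipWith _ _ (0 : ℤ) (0 : ℕ) _ _ (by rw [hM, List.length_range]), hM,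
    Finset.mul_sum, Finset.mul_sum]
  refine Finset.sum_congr rfl fun l hl => ?_
  rw [eval_smul, List.getD_eq_getElem?_getD (l := List.range b.U.length),
    List.getElem?_range (mem_range.1 hl), Option.getD_some, eval_symTabG, ← hW]
  push_cast
  ring

/-- `eval (FPolyX n d bs) = W · FvalX n bs` when all blocks are well-shaped. -/
theorem eval_FPolyX (n d : ℕ) (bs : List FBlkX) (h : ∀ b ∈ bs, fblkShapeOK d b = true) (u v t : ℝ) :
    eval (FPolyX n d bs) u v t = (Wfac d : ℝ) * FvalX n bs u v t := by
  unfold FPolyX FvalX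
  rw [eval_mergeAll, List.map_map, ← List.sum_map_mul_left]
  exact congrArg List.sum (List.map_congr_left fun b hb => by
    simp only [Function.comp_apply]; rw [eval_FbPolyX n d b (h b hb)])

/-- `FvalX` is symmetric in its first two arguments. -/
theorem FvalX_swap12 (n : ℕ) (bs : List FBlkX) (u v t : ℝ) : FvalX n bs u v t = FvalX n bs v u t := by
  unfold FvalX blkValX
  congr 1; refine List.map_congr_left fun b _ => ?_
  refine Finset.sum_congr rfl fun a _ => Finset.sum_congr rfl fun l _ => ?_
  rw [sym6_swap12]

/-- `FvalX` is symmetric in its last two arguments. -/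
theorem FvalX_swap23 (n : ℕ) (bs : List FBlkX) (u v t : ℝ) : FvalX n bs u v t = FvalX n bs u t v := by
  unfold FvalX blkValX
  congr 1; refine List.map_congr_left fun b _ => ?_
  refine Finset.sum_congr rfl fun a _ => Finset.sum_congr rfl fun l _ => ?_
  rw [sym6_swap23]

/-- **Three-point positivity of a lifted face block** ((pos S) of Bachoc–Vallentin termwise, via the
nonnegative pairing of `S` with the kernel `Φ(c,e) = Σ_{C³} y_c(x·y) y_e(x·z) Q(…)`). -/
theorem tripleSum_blkValX_nonneg {n : ℕ} (hn : 4 ≤ n) (d : ℕ) (b : FBlkX) (hb : fblkShapeOK d b = true)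
    (C : Finset (EuclideanSpace ℝ (Fin n))) (hC : ∀ x ∈ C, ‖x‖ = 1) :
    0 ≤ BachocVallentin.tripleSum C (blkValX n b) := by
  obtain ⟨hk, hL⟩ := fblkShapeOK_spec d b hb
  have hT : BachocVallentin.tripleSum C (blkValX n b) =
      6 * ∑ a ∈ range b.U.length, ∑ l ∈ range b.U.length, ((MrowU b.U (Srows b.psd) b.psd.f a).getD l 0 : ℝ) *
        BachocVallentin.tripleSum C (fun u v t => u ^ a * v ^ l * BachocVallentin.Q n b.k u v t) := by
    unfold blkValX
    rw [tripleSum_finsum, Finset.mul_sum]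
    refine Finset.sum_congr rfl fun a _ => ?_
    rw [tripleSum_finsum, Finset.mul_sum]
    refine Finset.sum_congr rfl fun l _ => ?_
    rw [tripleSum_const_mul, BachocVallentin.tripleSum_sym6]
    ring
  rw [hT, sumMU_eq b.U b.psd hL]
  refine mul_nonneg (by norm_num) ?_
  have hΦ : ∀ c e : ℕ, ∑ j ∈ range b.U.length, ∑ l ∈ range b.U.length,
      (Uent b.U j c : ℝ) * (Uent b.U l e : ℝ) *
        BachocVallentin.tripleSum C (fun u v t => u ^ j * v ^ l * BachocVallentin.Q n b.k u v t) =
      BachocVallentin.tripleSum C (fun u v t =>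
        (∑ j ∈ range b.U.length, (Uent b.U j c : ℝ) * u ^ j) *
        (∑ l ∈ range b.U.length, (Uent b.U l e : ℝ) * v ^ l) * BachocVallentin.Q n b.k u v t) := by
    intro c e
    have ex : (fun u v t =>
        (∑ j ∈ range b.U.length, (Uent b.U j c : ℝ) * u ^ j) *
        (∑ l ∈ range b.U.length, (Uent b.U l e : ℝ) * v ^ l) * BachocVallentin.Q n b.k u v t) =
        fun u v t => ∑ j ∈ range b.U.length, ∑ l ∈ range b.U.length,
          (Uent b.U j c : ℝ) * (Uent b.U l e : ℝ) * (u ^ j * v ^ l * BachocVallentin.Q n b.k u v t) := by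
      funext u v t
      rw [Finset.sum_mul_sum, Finset.sum_mul]
      refine Finset.sum_congr rfl fun j _ => ?_
      rw [Finset.sum_mul]
      refine Finset.sum_congr rfl fun l _ => ?_
      ring
    rw [ex, tripleSum_finsum]
    refine Finset.sum_congr rfl fun j _ => ?_
    rw [tripleSum_finsum]
    refine Finset.sum_congr rfl fun l _ => ?_
    rw [tripleSum_const_mul]
  rw [Finset.sum_congr rfl fun c _ => Finset.sum_congr rfl fun e _ => by rw [hΦ c e]]
  refine psd_pairing b.psd hL.hp _ (fun c e => ?_) (fun g => ?_)
  · rw [← BachocVallentin.tripleSum_perm12 C]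
    congr 1; funext u v t
    rw [Q_swap]; ring
  · have ex : ∑ i ∈ range b.psd.f, ∑ j ∈ range b.psd.f, g i * g j *
        BachocVallentin.tripleSum C (fun u v t =>
          (∑ j' ∈ range b.U.length, (Uent b.U j' i : ℝ) * u ^ j') *
          (∑ l ∈ range b.U.length, (Uent b.U l j : ℝ) * v ^ l) * BachocVallentin.Q n b.k u v t) =
        BachocVallentin.tripleSum C (fun u v t =>
          (∑ i ∈ range b.psd.f, g i * ∑ j' ∈ range b.U.length, (Uent b.U j' i : ℝ) * u ^ j') *
          (∑ j ∈ range b.psd.f, g j * ∑ l ∈ range b.U.length, (Uent b.U l j : ℝ) * v ^ l) *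
          BachocVallentin.Q n b.k u v t) := by
      have e2 : (fun u v t =>
          (∑ i ∈ range b.psd.f, g i * ∑ j' ∈ range b.U.length, (Uent b.U j' i : ℝ) * u ^ j') *
          (∑ j ∈ range b.psd.f, g j * ∑ l ∈ range b.U.length, (Uent b.U l j : ℝ) * v ^ l) *
          BachocVallentin.Q n b.k u v t) = fun u v t => ∑ i ∈ range b.psd.f, ∑ j ∈ range b.psd.f,
            g i * g j * ((∑ j' ∈ range b.U.length, (Uent b.U j' i : ℝ) * u ^ j') *
              (∑ l ∈ range b.U.length, (Uent b.U l j : ℝ) * v ^ l) * BachocVallentin.Q n b.k u v t) := by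
        funext u v t
        rw [Finset.sum_mul_sum, Finset.sum_mul]
        refine Finset.sum_congr rfl fun i _ => ?_
        rw [Finset.sum_mul]
        refine Finset.sum_congr rfl fun j _ => ?_
        ring
      rw [e2, tripleSum_finsum]
      refine Finset.sum_congr rfl fun i _ => ?_
      rw [tripleSum_finsum]
      refine Finset.sum_congr rfl fun j _ => ?_
      rw [tripleSum_const_mul]
    rw [ex]
    exact BachocVallentin.tripleSum_weight_nonneg hn b.k
      (fun w => ∑ i ∈ range b.psd.f, g i * ∑ j' ∈ range b.U.length, (Uent b.U j' i : ℝ) * w ^ j') C hC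

/-- **Positivity of the three-point part** over any finite set of unit vectors of `ℝⁿ`, `n ≥ 4`. -/
theorem tripleSum_FvalX_nonneg {n : ℕ} (hn : 4 ≤ n) (d : ℕ) (bs : List FBlkX)
    (h : ∀ b ∈ bs, fblkShapeOK d b = true) (C : Finset (EuclideanSpace ℝ (Fin n))) (hC : ∀ x ∈ C, ‖x‖ = 1) :
    0 ≤ BachocVallentin.tripleSum C (FvalX n bs) := by
  unfold FvalX
  rw [tripleSum_listSumG]
  refine List.sum_nonneg ?_
  intro x hx
  rw [List.mem_map] at hx
  obtain ⟨b, hb, rfl⟩ := hx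
  exact tripleSum_blkValX_nonneg hn d b (h b hb) C hC

end Summit.Ventures.PackingBounds.ThreePointCert

end
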